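import Mathlib
import HarnessLib
import HarnessLib.Audit
import Summits.FinalStateConjecture.Statement
import Literature.Geometry.Lorentzian.WeightedNorms
import Literature.Geometry.Lorentzian.KerrData
import Literature.Geometry.Lorentzian.LeviCivita
import Summits.FinalStateConjecture.FinalStateConjecture.Theorems.PhaseMixingCaptureAssemblyFrame

/-!
Route: PhaseMixingCapture

DORMANT since 2026-09-04T17:27:45Z (reconciler: no traction for 5 d (last activity statement-checked at 2026-08-30T16:35:58Z); parked, not closed — `ledger route dormant route-FinalStateConjecture-PhaseMixingCapture --off` to reactivate) — unstaffed, not closed; items shared with open routes are served there. `ledger route dormant <id> --off` reactivates.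

It suffices to show X = X_near ∧ X_bulk ∧ W ∧ S. X_near (NearExtremalKappaCapture, rank 2; card K2):
nonlinear asymptotic
stability of the Kerr exterior on the near-extremal range a₁M ≤ |a| < M, data on the
horizon-penetrating Kerr–Schild leaf
{t* = 0, r > M}, with basin c(M)·χ^γ and final-parameter modulus C(M)·χ^(−p)·√dist, χ = 1 − a²/M² ≍
(κM)² — constants that are
EXPLICIT POWERS of the surface gravity κ, never "depending on a in an uncontrolled way". X_bulk
(BulkKerrCaptureC2, rank 4):
sub-extremal capture in the bulk |a| ≤ a₁M in import grade — Hintz 2026 shape (b-conormal data,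
qualitative nearness) with
the convergence order pinned to the summit's C² (typing ruling 2026-08-16: the consumer must RECEIVE
k = 2, not an adversarial
∃k). W (WeakCosmicCensorshipTame, rank 5; re-typed 2026-08-16 after the statement revision p126844):
TAME-Christodoulou-generically
(one fixed end, weighted C²₋₁ × C¹₋₂ continuity, immersed at c = 0 — the summit's own genericity
notion) admissible data have
an MGHD and every MGHD has complete 𝓘⁺. S (CaptureSufficesTame, rank 6): granted X_near, X_bulk, W
the RE-TYPED summit follows
BY NAME — the large-data front end as ONE typed conditional, which now also owes the revision's new
conjuncts where it BUILDS
the decomposition witness (honest near-zone radii Rᵢ → ∞, Rᵢ ≥ max(r₊, 0) + 1 in the ∃R 3-tuple of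
HasExhaustiveCharts;
IsFutureOriented charts; RaysStayInClosure), to be split in layer 2. The engine's linear floor is
the deciding crux KappaExplicitWaveDecay (rank 3; κ-explicit DRSR
boundedness + integrated decay on the whole sub-extremal range) with its m = 0 case and the
nonlinear upgrade as supports;
the pre-ruling rank-4/6 statements BulkKerrCapture / CaptureSuffices and the pre-revision rank-5/6
statements
WeakCosmicCensorshipMGHD (plain genericity; implied by W) / CaptureSufficesC2 (implies S) stay in
the file as supports
(implication records).
Realises card extremality-is-phase-mixing-hypocoercive-capture (spine;
aretakis-is-filamentation-landau-damping merged: its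
Gevrey-price/echo fork is this route's kill switch).
Lean: `NearExtremalKappaCapture ∧ BulkKerrCaptureC2 ∧ WeakCosmicCensorshipTame ∧
CaptureSufficesTame`

## Assembly
Pure logic (theorem `closes`, crux-only): CaptureSufficesTame is by definition the implication
NearExtremalKappaCapture → BulkKerrCaptureC2 → WeakCosmicCensorshipTame → FinalStateConjecture (the
summit by name, hence in its
revised form), so the four cruxes give the summit by modus ponens. The pre-revision pair is wired in
by two one-line
implications (Sketch.lean of the repair seat, rc 0): WeakCosmicCensorshipTame →
WeakCosmicCensorshipMGHD
(IsTameChristodoulouGeneric.isChristodoulouGeneric) and CaptureSufficesC2 → CaptureSufficesTame, so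
a proof of the old front end
still closes the route. KappaExplicitWaveDecay feeds rank 2 through the support
NonlinearKappaUpgrade; AxisymmetricKappaWaveDecay
is its m = 0 case; BulkKerrCapture (pre-ruling strong form) implies nothing load-bearing and
CaptureSuffices (pre-ruling
conditional) is implied by CaptureSufficesC2 given a C⁰→C² upgrade of bulk capture (Sketch2.lean
`captureSuffices_of_C2`).
Sanity: FinalStateConjecture → WeakCosmicCensorshipTame (IsTameChristodoulouGeneric.mono; landed as
Theorems/PhaseMixingCaptureCaptureSufficesC2DiagonalReduction.tameCensorship_of_finalStateConjecture)
and → CaptureSufficesTame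
(both necessary), hence also → WeakCosmicCensorshipMGHD.

Rationale: WHY THIS LINE. Dictionary (weakly collisional plasma ↦ near-extremal horizon): collision frequency ν
↦ surface gravity κ;
free transport / filamentation ↦ the near-horizon dilation flow and Aretakis growth of transversal
derivatives; hypocoercive
friction ↦ the Dafermos–Rodnianski red-shift commutator, whose coercivity constant is ∝ κ;
enhanced-dissipation time ν^(−1/3) ↦
transient window v ≲ κ⁻¹ (GrallaZimmermanZimmerman2016; AngelopoulosKehleUnger2026 Thm 4 in
symmetry); Landau damping with
Gevrey price ↦ the kill switch (super-polynomial loss). Imported from kinetic theory: the FORMAT of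
the answer — uniform-in-ν
theorems whose constants degrade like a POWER of the small parameter instead of collapsing
(Villani2009, arXiv:1704.00425,
arXiv:2104.05692) — pointed at the one place the Kerr programme has no rate: DRSR / SR–TdC reach |a|
< M by
continuity in a ("constants blow up as a₀ → M", DafermosRodnianskiShlapentokhrothman2014 p.16;
ShlapentokhrothmanCosta2023).
THE LEVER, mechanism grade (built by this route's crux chain since filing, 2026-08-16). (L1,
frequency side, deciding crux
rank 3) In the blown-up radius x = (r − r₊)/(r₊ − r₋) the s = 0 radial Teukolsky equation is EXACTLY
Olver's form
W″ = (m²f + g)W with rational f, horizon = double pole with exponents ½ ± iξ, ξ = (ω − mΩ_H)/(2κ),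
and κ enters ONLY through
ξ, the Jacobian dr*/dx and the end normalisations (LANDED sorry-free:
Theorems/PhaseMixingCaptureKappaExplicitWaveDecay
OlverNormalForm.lean); the classically forbidden set of the principal symbol K² − ΔΛ′ on (r₊, ∞) is
ONE interval for every
real frequency — no well, hence ≤ 2 turning points and a finite coalescence census (LANDED:
…ConeCensus.lean; the quartic has
no cubic term, P′ is convex); so the corner {κ → 0} × {ω → mΩ_H} × {|m| → ∞}, the only regime where
DRSR is not already
uniform in a (Gajic2023 §1.4: "uncharted"), becomes a ONE-large-parameter (u = |m|)
uniform-asymptotics problem for a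
single ODE, covered chart by chart by Liouville–Green with Olver's error-control function (Olver1974
Ch. 6 Thms 2.1–2.2,
held; LG is EXACT on the Euler stretch 1 ≪ x ≪ κ⁻¹ after the Langer split, ibid. Ex. 1.4, so the
error variation is
κ-independent there), Airy/Weber at the barrier (in-throat trapping with Lyapunov exponent exactly κ
— desk check
λ_t/κ → 1.000, Olver1975) and Bessel K_{2iξ}, I_{2iξ} at the double pole (Dunster1990). OUTPUT = the
cone Green's function
u_𝓗(r_<)u_𝓘(r_>)/𝔚 with DENOMINATOR |𝔚|⁻¹ ≤ C|m|^N κ^(−N) for all m ≠ 0 (registered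
stub_coneWronskianBound; kit j012289:
min|𝔚|²/κ = 6.25 (2,2), 12.0 (3,3), 17.9 (5,5), 512 (16,21), κ-INDEPENDENT to 3–4 digits, so N = ½
is attained — the tree
erratum on TdC Prop. 6.3) and KERNEL bounded by C|m|^N κ^(−N)|𝔚| beyond the red-shift collar
(stub_coneGreenKernel, the
hardest stub: "across a single barrier the dominant term cannot cancel"); variation of parameters +
DRSR §§9–12 with
b_red ≍ κ give ILED (clause b), and an a-UNIFORM energy identity (stub_energyFromLocalEnergy) gives
boundedness (a) from
(b) with the same κ-power — composition kernel-checked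
(Cruxes/KappaExplicitWaveDecay/Lines/olver_dunster_uniform_
reduction.lean, 7 stubs, KappaExplicitWaveDecay_of sorry-free). (L2, physical side, ranks 2/9) the
κ-EXPLICIT red-shift:
on 𝓗⁺ the DR multiplier N = (1 + h₁(r − r₊))K + (1 + f₁(r − r₊))k with h₁ = f₁ = 16/(M²κ)-size
parameters gives
(κ/2)(λ² + v² + |∇̸|²) ≤ K^N — LANDED as
Literature.Geometry.Lorentzian.Kerr.redShift_horizon_coercive_kappa — the first
brick of the hypocoercive energy E_κ whose mixed terms must absorb Aretakis growth over the window v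
≲ κ⁻¹ at polynomial cost.
STANDING EVIDENCE for the κ-power law (disprover, kit j013848, s = 0 radial ODE, a = 0.9…0.99999, ℓ
= m ≤ 16):
1/|W| ≍ κ^(−0.50), horizon transversal derivative per unit incidence ≍ κ^(−1.5) (≍ κ^(−1/2) for a
κ-band-limited packet,
the CGZ/GZZ rate), exponents INDEPENDENT of m to three digits, superradiant gain saturating, growth
in m at fixed κ only
polynomial (≈ m^1.3) — no kill signal; Disproof.lean (0 sorry): □ψ = 0 and the IsSubextremal guard
are load-bearing
(Negative/FalseWithoutWaveEq(ILED).lean landed), the m = 0 sector is the robust one (attack |m| ≥ 2,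
m → ∞). WHY THIS
FORM IS EASIER than the qualitative full-range theory: no κ → 0 matching region, no face operator to
invert h-uniformly, no
spectral input beyond real-axis mode stability (Shlapentokhrothman2014, Costa2019 —
proved/vendored); what is left is a
semialgebraic census (decidable; done), variation bookkeeping of explicit rational error-control
functions, and reading
|𝔚| and the kernel off printed connection formulae with error bounds that are uniform in the
POSITION of the transition
points, so |m| → ∞ and κ → 0 decouple. What the line does that nothing in the tree or in print does:
(i) the first
non-vacuous typed capture statements at large spin (over VacuumCauchyDevelopment); (ii) a statement
and an attack on Kerr
with constants polynomial in κ — AngelopoulosKehleUnger2026 Thm 1 (uniform stability of the RN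
family incl. the extremal
member, spherical symmetry) and their Conj. 1 (Kerr–Newman threshold) are the nearest printed
objects, Hintz2026 /
KlainermanSzeftel2023 are qualitative in a, Gajic2023 / CasalsGrallaZimmerman2016 describe κ = 0
mode by mode; (iii) it closes
the "last e-fold": with a basin polynomial in κ a dynamical front end need only bring generic
exteriors polynomially close
to the Kerr family relative to κ, not bounded away from extremality. Negatives index (2026-08-16): 1
entry
(not_UniformPhotonSphereChannels, Schwarzschild photon-sphere channels) — unrelated to every item
here.

RANKED CRUXES. #2 NearExtremalKappaCapture (crux; card K2) — ∃(s, δ, k, γ, p), a₁ < 1, ∀M ∃c, C: for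
a₁M ≤ |a| < M, vacuum
data on Kerr.slice a M within H^s_δ-distance c·χ^γ of Kerr.data M a M have all MGHDs far-complete
(sojourn form inlined),
a region converging in C^k to a SUB-extremal Kerr, |M′ − M| + |a′ − a| ≤ C·χ^(−p)·√dist. (why it
might fail: for m ≠ 0 the
superradiant gap at ω = mΩ_H closes as a → M and |Yψ_m| ~ v^(1/2) already at κ = 0 — basin/modulus
may shrink like exp(−c/κ) or
carry a Gevrey loss; the KS/GKS modulus is unprinted beyond |a| ≪ M (Hintz2026 qualitative); as
typed, ∃(s,δ,k,γ,p) hands a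
consumer only adversarial witnesses (k = 0; γ ≥ 1 forced by Negative/NakedMemberThresholds) —
successor with k := 2 foreseen,
TWO-LAYER PLAN.) [AngelopoulosKehleUnger2026, AngelopoulosKehleUnger2024, Dafermos2025, Hintz2026,
KlainermanSzeftel2023,
GiorgiKlainermanSzeftel2022, Gajic2023, CasalsGrallaZimmerman2016, MaSzeftel2024, KehleUnger2025]
Line in build:
polynomial-closure (C⁺ = κ-polynomial Teukolsky slab law, shared with rank 3 at spin ±2; transfer
stub_polynomialClosingBox).
#3 KappaExplicitWaveDecay (crux, DECIDING; card K1 in output form) — ∀M ∃(p, j): (a) sliceEnergy(ψ,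
τ) ≤ C(M)·χ^(−p)·E_j[ψ](0)
for every |a| < M, every admissible wave (smooth on {r > r₊}, □_g ψ = 0, data compactly supported on
{t* = 0}) and τ ≥ 0;
(b) ∫₀^∞ E_loc(τ, R) dτ ≤ C(M, R)·χ^(−p)·E_j[ψ](0). Negation = super-polynomial degeneration at
every finite regularity.
(why it might fail: the whole difficulty is the corner κ → 0, ω → mΩ_H, |m| → ∞ where trapping meets
superradiance (Gajic2023
§1.4); TdC Prop. 6.3 as registered is false (|𝔚|² ≍ κ at the threshold ⇒ p ≥ 1/2 forced); an
m-drifting κ-exponent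
A_m ≍ κ^(−cm), or a degenerate Weber configuration at the A₂ corner Λ → 2m² (Lyapunov exponent → 0),
kills finite (p, j).)
[DafermosRodnianskiShlapentokhrothman2014, Costa2019, Shlapentokhrothman2014, Gajic2023,
GrallaZimmermanZimmerman2016,
CasalsGrallaZimmerman2016, Olver1974, Olver1975, Dunster1990, ShlapentokhrothmanCosta2020,
DafermosRodnianski2005, Aretakis2012]
#4 BulkKerrCaptureC2 (crux; imported, typing ruling 2026-08-16) — ∀a₁ < 1 ∃(s, δ) ∀M ∀η ∃ε: for |a|
≤ a₁M, b-conormal vacuum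
data (∀s′, dist_{s′,δ} < ⊤) within H^s_δ-distance ε of Kerr.data M a M have all MGHDs far-complete,
a region converging in
C² to a sub-extremal Kerr g_(M′,a′), |M′ − M| + |a′ − a| ≤ η. = Hintz2026 Thm 1.1/13.1 + Rem 13.2 in
the tree's Cauchy
consequence form, uniformised on compact spin sets by a Lebesgue number (pattern LANDED:
Theorems/PhaseMixingCaptureBulkKerr
CaptureFaithfulOfClaim.lean), with k pinned to 2. NO IDEATION NEEDED: closes by porting that file
once the claim
hintz_kerr_stability_subextremal_cauchy is re-vendored with universal (or explicit) convergence
order — cite item filed.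
(why it might fail: Hintz 2026 is a 300-page Nash–Moser claim under review; its data are
H_b^∞-conormal with O(r^(−1−ε₀))
tails and its convergence regularity is printed for smooth data only — the finite-s ball and the
fixed C² order at the fixed
leaf r₀ = M may exceed Thm 13.1 (audit SlowlyRotatingKerrFrontierProofs §ReviewSplitAudit (ii)).)
[Hintz2026,
KlainermanSzeftel2023, GiorgiKlainermanSzeftel2022, MaSzeftel2024, Klainerman2025, arXiv:2410.03639]
#5 WeakCosmicCensorshipTame (crux; imported: the first conjunct-structure of the summit AS RE-TYPED
2026-08-16, p126844) —
for every connected T2 second-countable smooth 3-manifold X, TAME-Christodoulou-generically in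
admissibleVacuumData X
(IsTameChristodoulouGeneric … 1: the escaping one-parameter family lives on one fixed AF end, is
jointly smooth, continuous at
c = 0 in the Dafermos–Rodnianski weighted C²₋₁ × C¹₋₂ distance, injective, immersed at c = 0): an
MGHD exists and every MGHD
has complete 𝓘⁺ (sojourn form). Necessary (the summit implies it by IsTameChristodoulouGeneric.mono
— landed as
tameCensorship_of_finalStateConjecture); implies the pre-revision item WeakCosmicCensorshipMGHD
(tame ⇒ plain genericity),
now a support; verbatim the stub_tameCensorship that line censorship-enters-diagonally of the old
front end had to carry as an
extra stub; the MGHD conjunct is dischargeable from the vendored Choquet-Bruhat–Geroch fact. (why it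
might fail: it is weak
cosmic censorship for one-ended AF vacuum data, open outside spherical symmetry; vacuum naked
singularities exist
non-generically (arXiv:1912.08478); TAME codimension one is strictly more demanding than
curve-genericity — the escaping
family must stay on the datum's own end with continuous ADM mass, so burial / rescaling witness
families (SwallowTheDatum,
retired 2026-08-16) are unavailable and only genuine instability-of-naked-singularity mechanisms
(Christodoulou, Ann. Math.
149, in symmetry) can supply witnesses.) [Christodoulou1999, doi:10.2307/121023, arXiv:1912.08478,
arXiv:0811.0354,
arXiv:1710.01722, KehleUnger2025] Lines registered on the pre-revision item
(Cruxes/WeakCosmicCensorshipMGHD: scri-transfer /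
stability-certified-burial) must be re-read against tameness: a certified-burial family is not tame.
#6 CaptureSufficesTame (crux; the large-data front end as ONE typed conditional, re-typed
2026-08-16) —
NearExtremalKappaCapture → BulkKerrCaptureC2 → WeakCosmicCensorshipTame → FinalStateConjecture (by
name, i.e. the revised
summit). Content: the DYNAMICAL front end only — approach of generic exteriors to the Kerr family
along quiet windows, no
parking at extremality (where the κ-power basin of rank 2 makes polynomial closeness enough),
multi-hole bookkeeping,
exhaustive HONEST charts: the front end builds the decomposition witness, so it owes the revision's
new conjuncts — the ∃R
3-tuple of HasExhaustiveCharts (Rᵢ → ∞, Rᵢ(τ) ≥ max(r₊(Mᵢ, aᵢ), 0) + 1, convergence out to Rᵢ,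
covering), IsFutureOriented
(orthochronous motions; push-forwards of the transported Kerr timeVector / ∂₀ eventually
future-directed) and RaysStayInClosure.
The soft-burial reading of the pre-revision item (old-light-forces-soft-burial: bury the shrunk
datum in a slowly rotating Kerr
exterior) is DEAD — its witness families have M(c) ↛ M(0) / receding supports and are not tame. LINE
PORTS with one fewer
stub: censorship-enters-diagonally
(Theorems/PhaseMixingCaptureCaptureSufficesC2DiagonalReduction.finalStateConjecture_of_tameLayer
h₅ h₁ h₂ h₃, landed 2026-08-16) proves this item with h₅ := the hypothesis WeakCosmicCensorshipTame,
leaving the quiet-curve,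
margin-curve and tracked-capture stubs (tame genericities do not intersect, so censored ∧ quiet ∧
margin are composed ALONG
curves, isTameChristodoulouGeneric_of_relative). The pre-revision CaptureSufficesC2 implies this
item and stays as a support.
(why it might fail: granted capture + tame censorship, generic exteriors may approach the Kerr
family without converging (no
Liouville theorem for non-radiating exteriors beyond local rigidity, IonescuKlainerman obstruction),
park at extremality
tame-generically (third law false non-generically, KehleUnger2025), or recede as N ≥ 2
configurations; each relative
composition step is a parametric, whole-family version of the dynamics.) [arXiv:0904.0982,
arXiv:1205.6112, arXiv:0902.1173,
KehleUnger2025, AngelopoulosKehleUnger2026, Dafermos2025, Hintz2026]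
SUPPORT (not staffed as cruxes): WeakCosmicCensorshipMGHD (pre-revision rank 5, plain
IsChristodoulouGeneric; implied by #5;
definitionally LapseTrumpetKID.WeakCosmicCensorship, shared) and CaptureSufficesC2 (pre-revision
rank 6 over it; implies #6) —
implication records of the statement revision; AxisymmetricKappaWaveDecay (m = 0 case of #3; prover
verdict 2026-08-16:
open-problem-sized for clause (b) — κ-uniform Morawetz at m = 0 —, clause (a) = DR Thm 7.1 with
κ-tracking; supports landed
p84483, p84940); NonlinearKappaUpgrade (#3 → #2: Teukolsky κ-law + KS/GKS scheme with bootstrap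
constants polynomial in κ⁻¹);
BulkKerrCapture (pre-ruling strong form of #4: finite-regularity ball WITHOUT conormality + C√dist
modulus uniform on
|a| ≤ a₁M — exactly the unprinted residue on which three lines died,
Cruxes/BulkKerrCapture/Lines/*-dead.md; implies the
faithful ∃k form, Sketch.lean faithful_of_bulk'); CaptureSuffices (pre-ruling conditional; implied
by #6 given a C⁰ → C²
upgrade of bulk capture); Assembly (bookkeeping).

TWO-LAYER PLAN. TYPING RULING (planner, 2026-08-16; asked for by the standing disprover of the front
end,
Cruxes/CaptureSuffices/Disproof.lean §B/§G, and by three line leads of rank 4): capture statements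
consumed by the front end
must HAND OVER the summit's convergence order — k := 2 — instead of an adversarial ∃k; data topology
and regularity (s, δ)
stay existential (every front end in play glues, so its corrections are compactly supported and
finite in every H^s_δ —
old-light appendix (A)); the near-extremal exponents (γ, p) stay existential but are RECEIVED by the
consumer (γ ≥ 1 is
forced, Negative/NakedMemberThresholds). Installed additively (landed Theorems/**/Negative files
unfold the old bodies, so
nothing is restated in place): rank 4 → BulkKerrCaptureC2, rank 6 → CaptureSufficesC2, closes
rewired; rank 2 keeps ∃k
until its transfer stub (stub_polynomialClosingBox, kc) is built — leads should already state kc :=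
2; its successor
NearExtremalKappaCaptureC2 is added when CaptureSufficesTame is split into the dynamical children.
STATEMENT REVISION
(p126844, 2026-08-16T21:19Z; re-type T2: tame genericity on one fixed end, honest near-zone radii,
chart time orientation,
intrinsic lower bound on the settled region) installed the same additive way by the repair seat:
rank 5 → WeakCosmicCensorshipTame,
rank 6 → CaptureSufficesTame, closes rewired (h₄ h₁ h₂ h₃), the pre-revision pair demoted to
supports. FORESEEN SPLITS (k ≤ 3,
nothing filed now): CaptureSufficesTame ⇐ QuietWindowApproach → NoExtremalParking →
CaptureSufficesTame (needs the definition
ApproximateKerrConfiguration; NoExtremalParking = generically some window has ε ≤ c·minᵢ χᵢ^γ —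
where the κ-law pays);
NearExtremalKappaCapture ⇐ AxisymmetricNearExtremalCapture → NonAxisymmetricUpgrade →
NearExtremalKappaCapture;
KappaExplicitWaveDecay ⇐ AxisymmetricKappaWaveDecay → FixedAzimuthalModeLaw (per-m constants
polynomial in κ⁻¹ AND m) →
KappaExplicitWaveDecay (superseded in practice by the crux's registered 7-stub line).

KILL CRITERIA. ¬KappaExplicitWaveDecay closes the route `refuted:KappaExplicitWaveDecay` — by
Disproof.lean §6
(not_kappaExplicitWaveDecay_iff) a kill must exhibit, for every (p, j, C), an explicit admissible
wave beating the bound,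
i.e. a κ-exponent drifting without bound in m (A_m(κ) ≍ κ^(−c·m) in the corner |ω − mΩ_H| ≪ |m|) or
an exp(c/κ) / Gevrey
transient; either makes the merged card's Gevrey-price reading a NEW route (not a repair). A
super-polynomial cone Green
KERNEL along κ_n → 0 at the A₂ corner (Λ → 2m², degenerate barrier top) kills stub_coneGreenKernel
and, through the
composition, is the concrete form of that refutation. ¬NearExtremalKappaCapture with
KappaExplicitWaveDecay proved ⇒ the
obstruction is nonlinear (echo/feedback): pivot to the merged card's negative statement (echo
chains) as its own route.
¬BulkKerrCaptureC2 = Hintz's claim fails or does not give C² at finite order: re-vendor/repair rank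
4 from
KlainermanSzeftel2023 on |a| ≪ M and re-type the bulk as an open crux (the pre-ruling
BulkKerrCapture records that shape).
¬WeakCosmicCensorshipTame (a fortiori ¬WeakCosmicCensorshipMGHD) refutes the summit itself (hand the
witness to the negative
side). ¬CaptureSufficesTame (a fortiori ¬CaptureSufficesC2) = a tame-censored, Kerr-stable world
with generic non-settling data
(new final states / generic extremal parking): close and re-card as a refutation line. MOOTED if
AKU-type κ-UNIFORM capture (γ = 0) is proved for Kerr: rank 2 becomes a corollary and the
route should be superseded by a front-end route sharing CaptureSufficesTame.

NOT DECOMPOSED YET. The hypocoercive energy E_κ itself (mixed terms ⟨Yψ, ρ∂_ρψ⟩, Aretakis-weighted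
horizon terms, crossover
at v ≍ κ⁻¹) is the prover's construction above the landed κ-explicit red-shift, not an item; the
seven stubs of the
deciding crux's line (S1, S3 landed; S4 bounded-m cone Wronskian by small-gain (F)+(G); S2 Olver's
LG theorem as a
Mathlib-only statement; S5 the kernel; S6/S7 physical space) are registered on the crux and
deliberately NOT filed as
layer-2 items (the crux protocol supersedes a split). Per-azimuthal-mode statements, the Teukolsky s
= ±2 version of rank 3
(= C⁺ of the rank-2 line), the dependence on the leaf position r₀ (fixed at M), the codimension-one
statement AT κ = 0
(merged card K3, Dafermos2025 Conj. 6.1 shape), echo chains, third-law genericity, quiet windows and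
N ≥ 2 bookkeeping are
layer-2 children or other routes' cards attaching to CaptureSufficesTame.

CHEAPEST FALSIFIER. RUN since filing (no kill): (1) fixed-m transient/threshold scaling on Kerr a =
M(1 − δ) — kit j013848
(ℓ = m ≤ 16, 401 real frequencies per case in |ω − mΩ_H| ≤ 40κ): 1/|W| ≍ κ^(−0.50), |∂_rψ̃|_𝓗⁺ ≍
κ^(−1.5), m-independent;
(2) denominator floor j012289: min|𝔚|²/κ κ-independent, increasing in m; (3) no-well census: exact
Sturm count on 175 164
in-cone configurations (desk) + kit j008834 (42 484 incl. V₀ + V₁): zero wells — now a theorem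
(ConeCensus.lean); (4) corner
probe: 168 coalescence configurations down to κ ≈ 2·10⁻⁴: scale-free barrier-top curvature
x₀²q̃″(x₀) ≥ 0.043,
κ-independent. STILL CHEAPEST AND NOT RUN: the joint limit m ≍ κ^(−α) (α ∈ {1/4, 1/2, 1}) of the
same radial-ODE probe —
min|𝔚|, kernel sup on x′ ≥ θ and the ILED constant along (κ_n, m_n) → (0, ∞) through the BF line Λ =
2m² ± δ; polynomial ⇒
the finite-(p, j) law survives, super-polynomial in m at polynomial κ ⇒ Gevrey fork (kills rank 3 as
typed), exp(c/κ) ⇒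
route dead. Second cheapest: time-domain summation over m ≤ 64 of a κ-band-limited packet (do the
per-mode exponents sum at finite j?). Lookup half done: ShlapentokhrothmanCosta2023 /
arXiv:2410.03639 /
arXiv:2512.08917 (Maxwell, full sub-extremal + conditional extremal, 2025) do not track constants in
1 − |a|/M.

NUMBERS. κ(M, a) = √(M² − a²)/(r₊² + a²) = (r₊ − r₋)/(2(r₊² + a²)); κM ∈ [√χ/4, √χ/2], χ = 1 − a²/M²
(Kerr.mul_surfaceGravity_mem_Icc, landed) — "power of κ" = "power of χ" as the items are typed; leaf
r₀ = M ∈ (r₋, r₊) for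
every |a| < M, collar width r₊ − M = M√χ = 2Mr₊κ (Kerr.rPlus_sub_self_eq_surfaceGravity). Red-shift
on 𝓗⁺: coercivity κ/2
with multiplier parameters 16/(M²κ) (redShift_horizon_coercive_kappa). Horizon exponents ½ ± iξ, ξ =
(ω − mΩ_H)/(2κ)
(OlverNormalForm.lean (ii)). Probes: 1/|W| ≍ κ^(−0.502…−0.505) (m = 2…16), threshold minimiser ON
the in-throat barrier top
(ŝ* = 1.4…3.2 for m = 2…16), superradiant gain 3.50e-3 (1,1) … 4.6e-8 (16,16); min|𝔚|²/κ = 6.25,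
12.0, 17.9, 512 for
(ℓ,m) = (2,2), (3,3), (5,5), (16,21); TdC threshold normalisation |𝔚|² ≈ 490κ at (2,2). AKU 2026:
basin uniform in (M, e)
(γ = 0 in symmetry), transient up to v ~ 2π/κ. GZZ: E_obs ≍ κ⁻¹, ZDM damping ≍ κ uniformly in (ℓ,
m), excitation 1/|𝒞| ≲
e^(−πm/2). DRSR Thm 3.2: ILED loses one derivative at trapping (j ≥ 2); the cone kernel carries
|m|^N (j ≥ N + 2).
Gajic2023 at κ = 0, |m| ≥ 2: |Yψ_m|_𝓗⁺ ≳ τ^(1/2), non-degenerate energy non-decaying ⇒ p ≥ 1/2 in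
(b) is NECESSARY. Hintz2026:
data O(r^(−1−ε₀)) + finite expansion, convergence O(t*^(−2−ε)) on compact sets. Items after the
revision repair: 12 (5 cruxes #2–#6,
6 supports, 1 assembly).

DEFINITION REQUESTS. Kerr.surfaceGravity — DONE
(Literature/Geometry/Lorentzian/KerrSurfaceGravity.lean, with
surfaceGravity_eq_zero_iff and the two-sided √χ bounds). STILL WANTED: ApproximateKerrConfiguration
(topic
Summits/FinalStateConjecture/FinalStateConjecture/Theorems; for the split of CaptureSufficesTame):
an ε-approximate N-Kerr
configuration on a chart-time window [τ, τ + L] of a CauchyDevelopment (N boosted Kerr truncated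
slabs + a flat chart, C^k
deviations ≤ ε, pairwise disjoint near zones, covering clause as in FinalStateDecomposition).
CITE/FACT WANTED (filed):
re-vendoring of Hintz2026 Thm 1.1/13.1 + Rem 13.2 with the convergence order universal (∀k) or
explicit (k = 2) and the data
topology explicit (δ of the O(r^(−1−ε₀)) class), so that BulkKerrCaptureC2 closes by the
Lebesgue-number port. LITERATURE
WANTED (filed): Olver's full treatise Chs 10–13 (acq-04884), Olver1975 (acq-05826), Dunster1990
(acq-05827) for S5.

Novelty: Searches (2026-08-15 at filing, refreshed 2026-08-16): zbMATH "extremal Kerr wave equation decay"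
(15: Aretakis ×2, Giorgi–Wan arXiv:2212.13164, Gajic ×3, arXiv:2502.00210, arXiv:2511.08751),
"Teukolsky subextremal Kerr boundedness decay" (6: Costa2019, ShlapentokhrothmanCosta2020/2023,
Giorgi 1910.05630), "extremal Reissner-Nordström stability instability" ≥ 2018 (12: AAG, Apetroaie
2211.09182, AngelopoulosKehleUnger2024), "near-extremal Kerr stability surface gravity" (0),
"near-extremal black hole transient instability" (0), "degenerate horizon redshift uniform energy
estimates extremal limit" (0); lit galaxy search "near-extremal Kerr" --star all (17: QNM theses,
Hadar 2019 JT backreaction, arXiv:2010.00162, textbooks); 2026-08-16 arXiv API (OpenAlex/S2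
rate-limited, logged): "near-extremal Kerr" ≥ 2024 (1: hep-th log corrections 2502.18173), "extremal
Kerr stability" ≥ 2024 (1, irrelevant), "zero-damped modes Kerr" ≥ 2022 (3: QNM phenomenology
2510.05354, 2607.27043, 2607.28930), "Teukolsky extremal Kerr" ≥ 2024 (6: arXiv:2512.08917
Benomio–Teixeira da Costa Maxwell on full sub-extremal AND extremal Kerr, conditional at |a| = M;
arXiv:2407.10750 Giorgi–Wan Kerr–Newman; 2407.06926 numerical extremal hair), "wave equation
extremal Kerr" ≥ 2024 (4: arXiv:2410.03639 DHRT quasilinear waves full range, arXiv:2511.08751,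
arXiv:2606.29956 Fang–Giorgi–Wan strongly charged extremal KN, arXiv:2502.00210), "subextremal Kerr
uniform" ≥ 2024 (2: Hintz gluing 2408.06712/06715); lit gal  [refs: 2212.13164, 2502.00210, 2511.08751, 2010.00162, 2512.08917, 2407.10750, 2410.03639, 2606.29956, 2603.10378, 2606.28253, 2302.06636, 1402.7034, 1704.00425, 2104.05692, Costa2019, ShlapentokhrothmanCosta2020, AngelopoulosKehleUnger2024, Olver1974, AngelopoulosKehleUnger2026, DafermosRodnianskiShlapentokhrothman2014, ShlapentokhrothmanCosta2023, Gajic2023, CasalsGrallaZimmerman2016, GrallaZimmermanZi]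

Barriers (technique_class: hypocoercivity, phase-mixing, near-extremal, red-shift): - technique_class: hypocoercivity, phase-mixing, near-extremal, red-shift; deciding crux: uniform
asymptotics of one linear ODE with a large parameter (Liouville–Green with Olver error bounds,
Airy/Weber/imaginary-order-Bessel charts at censused coalescences), explicit 1-D cone Green's
function, semialgebraic census — frequency side, real axis, exact Kerr, |a| < M throughout.
- Literature.Barriers.FinalStateConjecture.AretakisInstability: met head-on and used — no item asks
for κ-INDEPENDENT non-degenerate horizon estimates or C^k convergence to an EXTREMAL hole; ranks 2/3
carry constants χ^(−p) blowing up polynomially as |a| → M, final holes are sub-extremal by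
conclusion, κ > 0 in every frequency stub (x = (r − r₊)/(r₊ − r₋) and ξ = (ω − mΩ_H)/2κ are
undefined at κ = 0); Gajic2023's non-decay at κ = 0 is why p ≥ 1/2 is booked, not fought.
- Literature.Barriers.FinalStateConjecture.AretakisInstabilityNarrow: outside its class by design
(uniform-in-spin NON-degenerate horizon estimates with non-degenerating constants): every estimate
here degenerates polynomially, none asks decay of transversal derivatives on 𝓗⁺ at |a| = M; the
transient-growth-then-decay of its item (iv) is what the κ-law quantifies.
- Literature.Barriers.FinalStateConjecture.KerrSuperradiance: no conserved Killing energy is asked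
to be coercive; superradiant frequencies are handled by explicit connection coefficients with the
horizon flux direction in the exponents ½ ± iξ (DRSR's evasion class, made pointwi

History (route lifecycle, newest last):
- 2026-08-16T06:39:16Z · rev 11: restated Assembly (stmt-FinalStateConjecture-9955 proved) — route-repair (ground-failed): restate the bookkeeping item Assembly (stmt-FinalStateConjecture-9955; the gate refuses --drop of an assembly). Blocking ground fl (planner-rground-FinalStateConjecture-PhaseMixin-3bea6647-0)
- 2026-08-16T06:41:22Z · rev 12: restated KappaCaptureThesis (stmt-FinalStateConjecture-14862) — render the target KappaCaptureThesis: its conjuncts are this route's own decls (ranks 2, 4, 5 | 6), reported 'missing' at add time only because the module's dec (planner-rrepair-FinalStateConjecture-PhaseMixi-8b5201b9-0)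
- 2026-08-16T06:43:14Z · rev 13: dropped KappaCaptureThesis — route-repair cleanup after the parallel ground-repair (rev 11, rground seat, restated Assembly := NearExtremalKappaCapture ∧ BulkKerrCapture ∧ WeakCosmicCensors (planner-rrepair-FinalStateConjecture-PhaseMixi-8b5201b9-0)
- 2026-08-16T07:06:51Z · rev 16: restated Assembly (stmt-FinalStateConjecture-14875) — promote-to-A step 3: Assembly (bookkeeping) re-pointed at the C2 successors (rev 15 installed BulkKerrCaptureC2/CaptureSufficesC2 and rewired closes); no Theore (planner-promote-FinalStateConjecture-PhaseMixi-3bea6647-0)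
- 2026-08-16T23:16:41Z · rev 19: restated Assembly (stmt-FinalStateConjecture-14987) — route-repair (statement revised p126844): bookkeeping Assembly re-pointed at the re-typed rank-5 crux WeakCosmicCensorshipTame (a proof of CaptureSufficesTame m (planner-rrepair-FinalStateConjecture-PhaseMixi-0a0fc589-0)
- 2026-08-24T13:40:37Z · DORMANT — reconciler: no traction for 6.8 d (last activity item-evidence-added at 2026-08-17T17:43:02Z); parked, not closed — `ledger route dormant route-FinalStateConjec (operator:999:1691068)
- 2026-08-30T02:45:51Z · REACTIVATED — reconciler: reactivated — activity statement-attached at 2026-08-30T01:52:06Z after parking at 2026-08-24T13:40:37Z (operator:999:959184)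
- 2026-09-04T17:27:45Z · DORMANT — reconciler: no traction for 5 d (last activity statement-checked at 2026-08-30T16:35:58Z); parked, not closed — `ledger route dormant route-FinalStateConjecture (operator:999:1477616)

sub-problem: FinalStateConjecture · status: dormant · opened planner-plancard-FinalStateConjecture-FinalSt-63c879a7-0 2026-08-15T14:57:10Z · rev 19 · ledger route-FinalStateConjecture-PhaseMixingCapture
GENERATED by the gate from the ledger (D-0016/17). Provers cite these decls: `theorem foo : Summit.FinalStateConjecture.FinalStateConjecture.Theses.PhaseMixingCapture.<Decl> := …` in Summits/FinalStateConjecture/FinalStateConjecture/Theorems/<Name>.lean.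
-/

namespace Summit.FinalStateConjecture.FinalStateConjecture.Theses.PhaseMixingCapture

open scoped BigOperators Topology Manifold Classical MeasureTheory ProbabilityTheory Matrix InnerProductSpace ComplexConjugate ContinuousMap
open Filter Set Function TopologicalSpace MeasureTheory

attribute [summit_statement] _root_.FinalStateConjecture

-- earlier NearExtremalKappaCapture (stmt-FinalStateConjecture-9949, replaced 2026-08-15T16:19:24Z -> stmt-FinalStateConjecture-10606): retired by None — ∀ [Literature.Geometry.Lorentzian.Kerr.Facts] [Literature.Geometry.Lorentzian.Kerr.SliceFacts], ∃ (s : ℕ) (δ : ℝ) (k : ℕ) (γ p a₁ : ℝ), a₁ < 1 ∧ ∀ (M : ℝ) (hM : 0 < M), ∃ c > (0 : ℝ), ∃ C : ℝ, ∀ a : ℝ, a₁ * M ≤ |a| → Literature.Geometry.Lorentzian.K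
/-- item stmt-FinalStateConjecture-10606 · crux · rank 2 · open · by planner
why it might fail: m≠0: superradiant gap ω=mΩ_H closes as a→M and |Yψ_m|~v^{1/2} already at κ=0 (Gajic23, CGZ16) ⇒ basin/modulus may shrink like exp(−c/κ) or lose Gevrey regularity; KS modulus unprinted beyond |a|≪M (Hintz26 qualitative); typed ∃(s,δ,k,γ,p) hands consumers only k=0 witnesses (γ≥1 forced).
sources: AngelopoulosKehleUnger2026, AngelopoulosKehleUnger2024, Dafermos2025, Hintz2026, KlainermanSzeftel2023, GiorgiKlainermanSzeftel2022
[crux] (card K2) there are exponents (s, δ, k, γ, p) and a₁ < 1 such that for every M > 0 there are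
c > 0 and C with: for every spin a with a₁M ≤ |a| < M, every solution D of the vacuum constraints on
the Kerr–Schild slice Kerr.slice a M = {t* = 0, r > M} (horizon-penetrating, r₋ < M < r₊) within
weighted-Sobolev distance c·(1 − (a/M)²)^γ of the Kerr data Kerr.data M a M has all its maximal
vacuum Cauchy developments with complete 𝓘⁺ as seen from the closed far region {‖y‖ ≥ Kerr.afRadius
a M + 1} of the slice (Christodoulou's sojourn form with far origins, INLINED by the cone repair of
2026-08-15: verbatim the body of `DataEmbedding.HasCompleteFutureNullInfinityFar` of
StabilityCauchy.lean, whose import dragged the Klainerman–Szeftel fact and Stability/ModelData into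
the cone; equivalence with the rev-1 text proved as `near_iff`), a region converging in C^k to a
SUB-extremal Kerr exterior g_(M′,a′) (`Spacetime.ConvergesToKerr`), and |M′ − M| + |a′ − a| ≤ C·(1 −
(a/M)²)^(−p)·√dist. Consequence-form conventions of the re-vendored Klainerman–Szeftel statement
(existential (s, δ, k), region 𝒟oc existential, modulus C√dist), with κ-explicit basin and modulus.
[difficulty: open-problem] -/
@[route_item "route-FinalStateConjecture-PhaseMixingCapture"]
def NearExtremalKappaCapture : Prop :=
  ∀ [Literature.Geometry.Lorentzian.Kerr.Facts] [Literature.Geometry.Lorentzian.Kerr.SliceFacts], ∃ (s : ℕ) (δ : ℝ) (k : ℕ) (γ p a₁ : ℝ), a₁ < 1 ∧ ∀ (M : ℝ) (hM : 0 < M), ∃ c > (0 : ℝ), ∃ C : ℝ, ∀ a : ℝ, a₁ * M ≤ |a| → Literature.Geometry.Lorentzian.Kerr.IsSubextremal M a → ∀ (D : Literature.Geometry.Lorentzian.InitialDataSet 𝓘(ℝ, Literature.Geometry.Lorentzian.E3) (Literature.Geometry.Lorentzian.Kerr.slice a M)) [D.metric.HasLeviCivita], D.IsVacuumConstraintSolution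 → Literature.Geometry.Lorentzian.InitialDataSet.dataWeightedSobolevEDist s δ D (Literature.Geometry.Lorentzian.Kerr.data M a M hM.le) < ENNReal.ofReal (c * (1 - (a / M) ^ 2) ^ γ) → ∀ 𝒟 : Literature.Geometry.Lorentzian.VacuumCauchyDevelopment D, 𝒟.IsMaximal → ∃ (M' a' : ℝ) (𝒟oc : Set 𝒟.carrier), Literature.Geometry.Lorentzian.Kerr.IsSubextremal M' a' ∧ (∀ [𝒟.metric.HasLeviCivita], ∃ B₀ : Set (Literature.Geometry.Lorentzian.Kerr.slice a M), IsCompact B₀ ∧ ∀ σ : ℝ, 0 < σ → ∃ B₁ : Set (Literature.Geometry.Lorentzian.Kerr.slice a M), IsCompact B₁ ∧ ∀ q ∈ {q : Literature.Geometry.Lorentzian.Kerr.slice a M | Literature.Geometry.Lorentzian.Kerr.afRadius a M + 1 ≤ ‖(q : Literature.Geometry.Lorentzian.E3)‖}, q ∉ B₁ → ∀ (ray : ℝ → 𝒟.carrier) (dom : Set ℝ), 𝒟.metric.IsNormalisedNullRayFrom 𝒟.timeOrientation 𝒟.embed 𝒟.normal q ray dom → ¬ BddAbove dom ∨ ENNReal.ofReal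 σ ≤ Literature.Geometry.Lorentzian.sojournTime ray dom (𝒟.metric.causalFuture 𝒟.timeOrientation (𝒟.embed '' B₀))) ∧ 𝒟.toSpacetime.ConvergesToKerr 𝒟oc M' a' k ∧ |M' - M| + |a' - a| ≤ C * (1 - (a / M) ^ 2) ^ (-p) * √(Literature.Geometry.Lorentzian.InitialDataSet.dataWeightedSobolevEDist s δ D (Literature.Geometry.Lorentzian.Kerr.data M a M hM.le)).toReal

-- earlier KappaExplicitWaveDecay (stmt-FinalStateConjecture-9950, replaced 2026-08-15T16:20:28Z -> stmt-FinalStateConjecture-10654): retired by None — ∀ [Literature.Geometry.Lorentzian.Kerr.Facts] [Literature.Geometry.Lorentzian.Kerr.SliceFacts], ∀ M : ℝ, 0 < M → ∃ (p : ℝ) (j : ℕ), (∃ C : ENNReal, C < ⊤ ∧ ∀ a : ℝ, Literature.Geometry.Lorentzian.Kerr.IsSubextremal M a → ∀ ψ : Literature.Geometry.Lore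
/-- item stmt-FinalStateConjecture-10654 · crux · rank 3 · open · by planner
why it might fail: All difficulty sits in the corner κ→0, ω→mΩ_H, |m|→∞ where trapping meets superradiance (Gajic 2023 §1.4: uncharted); TdC Prop 6.3 as registered is false (|𝔚|²≍κ at threshold ⇒ p≥1/2 forced); an m-drifting exponent A_m≍κ^{−cm} or a degenerate Weber point at the A₂ corner Λ→2m² kills finite (p,j).
sources: DafermosRodnianskiShlapentokhrothman2014, Costa2019, Shlapentokhrothman2014, Gajic2023, GrallaZimmermanZimmerman2016, CasalsGrallaZimmerman2016
[crux] (card K1, output form) κ-explicit DRSR on the whole sub-extremal range: for every M > 0 there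
are p and a derivative order j such that (a) uniform boundedness — for some C(M) < ∞, every |a| < M,
every admissible wave ψ (ψ smooth on the exterior {r > r₊}, □_g ψ = 0 for g = Kerr.smoothMetric M a
r₊, ψ and dψ vanishing on {t* = 0} outside a compact set — INLINED by the cone repair of 2026-08-15,
`Iff.rfl` with `IsAdmissibleKerrWave` of BlackHoles.lean whose import dragged the DRSR/Christodoulou
facts into the cone) and every τ ≥ 0: sliceEnergy(ψ, τ) ≤ C·(1 − (a/M)²)^(−p)·E_j[ψ](0), where
E_j[ψ](0) = ∫_{t*=0} Σ_{m≤j} ‖D^m ψ̃(0,y)‖² dy is the unweighted j-th order coordinate energy of the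
zero-extended ψ through the initial leaf (INLINED; = `sliceSobolevEnergy (Kerr.exterior M a) ψ 0 j 0
univ` of Sweep2.lean); (b) integrated local energy decay — for every coordinate radius R some C(M,R)
< ∞ with ∫₀^∞ E_loc(τ, R) dτ ≤ C·(1 − (a/M)²)^(−p)·E_j[ψ](0). Negation = super-polynomial
degeneration in every finite-regularity norm (the Gevrey-price scenario of the merged card).
Equivalence with the rev-1 text proved as `kappa_iff`. [difficulty: L] -/
@[route_item "route-FinalStateConjecture-PhaseMixingCapture"]
def KappaExplicitWaveDecay : Prop :=
  ∀ [Literature.Geometry.Lorentzian.Kerr.Facts] [Literature.Geometry.Lorentzian.Kerr.SliceFacts], ∀ M : ℝ, 0 < M → ∃ (p : ℝ) (j : ℕ), (∃ C : ENNReal, C < ⊤ ∧ ∀ a : ℝ, Literature.Geometry.Lorentzian.Kerr.IsSubextremal M a → ∀ ψ : Literature.Geometry.Lorentzian.Kerr.exterior M a → ℝ, (ContMDiff 𝓘(ℝ, Literature.Geometry.Lorentzian.E4) 𝓘(ℝ, ℝ) ((⊤ : ℕ∞) : WithTop ℕ∞) ψ ∧ (∀ x, (Literature.Geometry.Lorentzian.Kerr.smoothMetric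 M a (Literature.Geometry.Lorentzian.Kerr.rPlus M a)).toPseudoRiemannianMetric.dalembertian ψ x = 0) ∧ ∃ K : Set (Literature.Geometry.Lorentzian.Kerr.exterior M a), IsCompact K ∧ ∀ x : Literature.Geometry.Lorentzian.Kerr.exterior M a, (x : Literature.Geometry.Lorentzian.E4) 0 = 0 → x ∉ K → ψ x = 0 ∧ mfderiv 𝓘(ℝ, Literature.Geometry.Lorentzian.E4) 𝓘(ℝ, ℝ) ψ x = 0) → ∀ τ : ℝ, 0 ≤ τ → Literature.Geometry.Lorentzian.sliceEnergy (Literature.Geometry.Lorentzian.Kerr.exterior M a) ψ τ ≤ C * ENNReal.ofReal ((1 - (a / M) ^ 2) ^ (-p)) * ∫⁻ y : Literature.Geometry.Lorentzian.E3, {y | Literature.Geometry.Lorentzian.E4.ofTimeSpace 0 y ∈ Literature.Geometry.Lorentzian.Kerr.exterior M a}.indicator (fun y ↦ ENNReal.ofReal (∑ m ∈ Finset.range (j + 1), ‖iteratedFDeriv ℝ m (Function.extend Subtype.val ψ (0 : Literature.Geometry.Lorentzian.E4 → ℝ)) (Literature.Geometry.Lorentzian.E4.ofTimeSpace 0 y)‖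 ^ 2)) y) ∧ ∀ R : ℝ, ∃ C : ENNReal, C < ⊤ ∧ ∀ a : ℝ, Literature.Geometry.Lorentzian.Kerr.IsSubextremal M a → ∀ ψ : Literature.Geometry.Lorentzian.Kerr.exterior M a → ℝ, (ContMDiff 𝓘(ℝ, Literature.Geometry.Lorentzian.E4) 𝓘(ℝ, ℝ) ((⊤ : ℕ∞) : WithTop ℕ∞) ψ ∧ (∀ x, (Literature.Geometry.Lorentzian.Kerr.smoothMetric M a (Literature.Geometry.Lorentzian.Kerr.rPlus M a)).toPseudoRiemannianMetric.dalembertian ψ x = 0) ∧ ∃ K : Set (Literature.Geometry.Lorentzian.Kerr.exterior M a), IsCompact K ∧ ∀ x : Literature.Geometry.Lorentzian.Kerr.exterior M a, (x : Literature.Geometry.Lorentzian.E4) 0 = 0 → x ∉ K → ψ x = 0 ∧ mfderiv 𝓘(ℝ, Literature.Geometry.Lorentzian.E4) 𝓘(ℝ, ℝ) ψ x = 0) → ∫⁻ τ in Ioi (0 : ℝ), Literature.Geometry.Lorentzian.localSliceEnergy (Literature.Geometry.Lorentzian.Kerr.exterior M a) ψ τ R ≤ C * ENNReal.ofReal ((1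 - (a / M) ^ 2) ^ (-p)) * ∫⁻ y : Literature.Geometry.Lorentzian.E3, {y | Literature.Geometry.Lorentzian.E4.ofTimeSpace 0 y ∈ Literature.Geometry.Lorentzian.Kerr.exterior M a}.indicator (fun y ↦ ENNReal.ofReal (∑ m ∈ Finset.range (j + 1), ‖iteratedFDeriv ℝ m (Function.extend Subtype.val ψ (0 : Literature.Geometry.Lorentzian.E4 → ℝ)) (Literature.Geometry.Lorentzian.E4.ofTimeSpace 0 y)‖ ^ 2)) y

/-- item stmt-FinalStateConjecture-14985 · crux · rank 4 · open · by planner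
why it might fail: Hintz 2026 is an unrefereed Nash–Moser claim; its data are H_b^∞-conormal with O(r^(−1−ε₀)) tails and convergence is printed for smooth data — a finite-s ball and the fixed C² order at the fixed leaf r₀ = M may exceed Thm 13.1 (audit SlowlyRotatingKerrFrontierProofs §ReviewSplitAudit (ii)).
sources: Hintz2026, KlainermanSzeftel2023, GiorgiKlainermanSzeftel2022, MaSzeftel2024, Klainerman2025, arXiv:2410.03639
[crux] (imported; typing ruling 2026-08-16, successor of BulkKerrCapture as rank 4) sub-extremal
Kerr capture in the bulk in IMPORT GRADE with the convergence order HANDED OVER: for every a₁ < 1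
there are (s, δ) such that for every M > 0 and every tolerance η > 0 there is ε > 0 with: for every
|a| ≤ a₁M, every b-conormal (∀ s′, dist_{s′,δ} < ⊤) vacuum-constraint solution D on Kerr.slice a M
within H^s_δ-distance ε of Kerr.data M a M has all its maximal vacuum Cauchy developments
far-complete (sojourn form, inlined as in rank 2), a region converging in C² (k = 2, the summit's
order — NOT an adversarial ∃k) to a sub-extremal Kerr g_(M′,a′), and |M′ − M| + |a′ − a| ≤ η. =
Hintz 2026 Thm 1.1/13.1 + Rem 13.2 in the tree's Cauchy consequence form (b-conormal side condition,
qualitative nearness), uniformised on compact spin sets by the Lebesgue number of a finite subcover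
(pattern LANDED: Theorems/PhaseMixingCaptureBulkKerrCaptureFaithfulOfClaim.lean, p77821), with k
pinned to 2. NO IDEATION NEEDED: closes by porting that file once the claim
Literature.Geometry.Lorentzian.hintz_kerr_stability_subextremal_cauchy (p78222, vendored with ∃k) is
re-vendored with universal or explicit converge -/
@[route_item "route-FinalStateConjecture-PhaseMixingCapture"]
def BulkKerrCaptureC2 : Prop :=
  ∀ [Literature.Geometry.Lorentzian.Kerr.Facts] [Literature.Geometry.Lorentzian.Kerr.SliceFacts], ∀ a₁ : ℝ, a₁ < 1 → ∃ (s : ℕ) (δ : ℝ), ∀ (M : ℝ) (hM : 0 < M), ∀ η > (0 : ℝ), ∃ ε > (0 : ℝ), ∀ a : ℝ, |a| ≤ a₁ * M → ∀ (D : Literature.Geometry.Lorentzian.InitialDataSet 𝓘(ℝ, Literature.Geometry.Lorentzian.E3) (Literature.Geometry.Lorentzian.Kerr.slice a M)) [D.metric.HasLeviCivita], D.IsVacuumConstraintSolution → (∀ s' : ℕ, Literature.Geometry.Lorentzian.InitialDataSet.dataWeightedSobolevEDist s' δ D (Literature.Geometry.Lorentzian.Kerr.data M a M hM.le) < ⊤)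 → Literature.Geometry.Lorentzian.InitialDataSet.dataWeightedSobolevEDist s δ D (Literature.Geometry.Lorentzian.Kerr.data M a M hM.le) < ENNReal.ofReal ε → ∀ 𝒟 : Literature.Geometry.Lorentzian.VacuumCauchyDevelopment D, 𝒟.IsMaximal → ∃ (M' a' : ℝ) (𝒟oc : Set 𝒟.carrier), Literature.Geometry.Lorentzian.Kerr.IsSubextremal M' a' ∧ (∀ [𝒟.metric.HasLeviCivita], ∃ B₀ : Set (Literature.Geometry.Lorentzian.Kerr.slice a M), IsCompact B₀ ∧ ∀ σ : ℝ, 0 < σ → ∃ B₁ : Set (Literature.Geometry.Lorentzian.Kerr.slice a M), IsCompact B₁ ∧ ∀ q ∈ {q : Literature.Geometry.Lorentzian.Kerr.slice a M | Literature.Geometry.Lorentzian.Kerr.afRadius a M + 1 ≤ ‖(q : Literature.Geometry.Lorentzian.E3)‖}, q ∉ B₁ → ∀ (ray : ℝ → 𝒟.carrier) (dom : Set ℝ), 𝒟.metric.IsNormalisedNullRayFrom 𝒟.timeOrientation 𝒟.embed 𝒟.normal q ray dom → ¬ BddAbove dom ∨ ENNReal.ofReal σ ≤ Literature.Geometry.Lorentzian.sojournTime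 ray dom (𝒟.metric.causalFuture 𝒟.timeOrientation (𝒟.embed '' B₀))) ∧ 𝒟.toSpacetime.ConvergesToKerr 𝒟oc M' a' 2 ∧ |M' - M| + |a' - a| ≤ η

/-- item stmt-FinalStateConjecture-17269 · crux · rank 5 · open · by planner
why it might fail: = weak cosmic censorship (+MGHD) for one-ended AF vacuum data, open outside symmetry; vacuum naked singularities exist non-generically (RSR 2019); TAME codim 1 needs escaping families on the datum's own end with continuous ADM mass — burial/rescaling witnesses are gone.
sources: Christodoulou1999, doi:10.2307/121023, arXiv:1912.08478, arXiv:0811.0354, arXiv:1710.01722, KehleUnger2025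
[crux] (imported; re-typed successor of WeakCosmicCensorshipMGHD after the statement revision
p126844, re-type T2) TAME weak cosmic censorship in MGHD form: for every connected Hausdorff
second-countable smooth 3-manifold X, tame-Christodoulou-generically in admissibleVacuumData X
(IsTameChristodoulouGeneric … 1: the escaping one-parameter family lives on ONE fixed asymptotically
flat end, is jointly smooth, continuous at c = 0 in the Dafermos–Rodnianski weighted C²₋₁ × C¹₋₂
distance of that end, injective and immersed at c = 0) a maximal vacuum Cauchy development exists
and every MGHD has complete future null infinity (sojourn form,
Summit.FinalStateConjecture.HasCompleteNullInfinity). This is the first conjunct-structure of the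
RE-TYPED summit; NECESSARY (summit ⇒ it by IsTameChristodoulouGeneric.mono — Sketch.lean
tame_of_statement; landed as Theorems/PhaseMixingCaptureCaptureSufficesC2DiagonalReduction
tameCensorship_of_finalStateConjecture); it implies the pre-revision rank-5 item
WeakCosmicCensorshipMGHD (tame ⇒ plain genericity,
IsTameChristodoulouGeneric.isChristodoulouGeneric; landed as
weakCosmicCensorshipMGHD_of_tameCensorship), which stays in the file as a support / imp -/
@[route_item "route-FinalStateConjecture-PhaseMixingCapture"]
def WeakCosmicCensorshipTame : Prop :=
  ∀ (X : Type) [TopologicalSpace X] [ChartedSpace Literature.Geometry.Lorentzian.E3 X] [IsManifold (𝓡 3) ((⊤ : ℕ∞) : WithTop ℕ∞) X] [T2Space X] [SecondCountableTopology X] [ConnectedSpace X], Literature.Geometry.Lorentzian.InitialDataSet.IsTameChristodoulouGeneric (Literature.Geometry.Lorentzian.admissibleVacuumData X) (fun D ↦ (∃ 𝒟 : Literature.Geometry.Lorentzian.VacuumCauchyDevelopment D, 𝒟.IsMaximal) ∧ ∀ 𝒟 : Literature.Geometry.Lorentzian.VacuumCauchyDevelopment D, 𝒟.IsMaximal → Summit.FinalStateConjecture.HasCompleteNullInfinity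 𝒟.toCauchyDevelopment) 1

/-- item stmt-FinalStateConjecture-17270 · crux · rank 6 · open · by planner
why it might fail: Granted capture + tame censorship, generic exteriors may near the Kerr family without converging (no Liouville thm beyond local rigidity), park at extremality tame-generically, or recede as N ≥ 2 holes; tame genericities do not intersect, so each step is a whole-family version of the dynamics.
sources: arXiv:0904.0982, arXiv:1205.6112, arXiv:0902.1173, KehleUnger2025, AngelopoulosKehleUnger2026, Dafermos2025
[crux] (the large-data front end as ONE typed conditional; re-typed successor of CaptureSufficesC2
after the statement revision p126844, re-type T2) NearExtremalKappaCapture → BulkKerrCaptureC2 →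
WeakCosmicCensorshipTame → FinalStateConjecture: granted κ-explicit near-extremal capture,
C²-handing bulk sub-extremal capture and TAME-generic completeness of 𝓘⁺ with MGHD existence,
tame-generic admissible data settle down exhaustively to finitely many sub-extremal Kerr black holes
plus radiation — the summit BY NAME, so the revision new conjuncts are obligations of this front end
where its decomposition witness is BUILT: honest near-zone radii (HasExhaustiveCharts is now ∃ R, (∀
i, R i → ∞ ∧ ∀ τ, max (r₊(Mᵢ,aᵢ)) 0 + 1 ≤ R i τ) ∧ convergence ∧ covering — a 3-tuple),
future-oriented charts (IsFutureOriented: orthochronous motions, push-forwards of the transported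
Kerr timeVector / ∂₀ eventually future-directed) and the intrinsic lower bound RaysStayInClosure on
the settled region. Content: the DYNAMICAL front end only — approach of generic exteriors to the
Kerr family along quiet windows, no parking at extremality (where the κ-power basin of rank 2 makes
polynomial closeness enough), mul -/
@[route_item "route-FinalStateConjecture-PhaseMixingCapture"]
def CaptureSufficesTame : Prop :=
  NearExtremalKappaCapture → BulkKerrCaptureC2 → WeakCosmicCensorshipTame → FinalStateConjecture

-- earlier BulkKerrCapture (stmt-FinalStateConjecture-9951, replaced 2026-08-15T16:21:20Z -> stmt-FinalStateConjecture-10696): retired by None — ∀ [Literature.Geometry.Lorentzian.Kerr.Facts] [Literature.Geometry.Lorentzian.Kerr.SliceFacts], ∀ a₁ : ℝ, a₁ < 1 → ∃ (s : ℕ) (δ : ℝ) (k : ℕ), ∀ (M : ℝ) (hM : 0 < M), ∃ ε > (0 : ℝ), ∃ C : ℝ, ∀ a : ℝ, |a| ≤ a₁ * M → ∀ (D : Literature.Geometry.Lorentzian.Initia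
/-- item stmt-FinalStateConjecture-10696 · support · rank 4 · open · by planner
why it might fail: As a₁→1 this is the full sub-extremal Kerr stability conjecture: only |a|≪M proved (KS/GKS; a-smallness enters just the energy–Morawetz step, Ma–Szeftel 2410.02341 Rem 1.5: scalar waves done on |a|<M, Teukolsky/Bianchi not); an unstable sub-extremal spin or ε non-uniform on |a|≤a₁M at r₀=M kills it.
sources: Hintz2026, KlainermanSzeftel2023, GiorgiKlainermanSzeftel2022, MaSzeftel2024, Klainerman2025
[crux] (imported: sub-extremal Kerr stability in the bulk, constants uniform on compact spin sets)
for every a₁ < 1 there are (s, δ, k) such that for every M > 0 there are ε > 0 and C with: for every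
|a| ≤ a₁M, every vacuum-constraint solution D on Kerr.slice a M within distance ε of Kerr.data M a M
has all its maximal vacuum Cauchy developments with complete 𝓘⁺ as seen from the closed far region
{‖y‖ ≥ Kerr.afRadius a M + 1} of the slice (sojourn form, INLINED by the cone repair of 2026-08-15:
verbatim the body of `DataEmbedding.HasCompleteFutureNullInfinityFar`; equivalence with the rev-1
text proved as `bulk_iff`), a region converging in C^k to a sub-extremal Kerr g_(M′,a′), and |M′ −
M| + |a′ − a| ≤ C·√dist. For small a₁ this is the Klainerman–Szeftel/GKS theorem in the re-vendored
Cauchy form (up to uniformity in a on |a| ≤ a₁M and the fixed slice r₀ = M). [difficulty: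
open-problem] -/
@[route_item "route-FinalStateConjecture-PhaseMixingCapture"]
def BulkKerrCapture : Prop :=
  ∀ [Literature.Geometry.Lorentzian.Kerr.Facts] [Literature.Geometry.Lorentzian.Kerr.SliceFacts], ∀ a₁ : ℝ, a₁ < 1 → ∃ (s : ℕ) (δ : ℝ) (k : ℕ), ∀ (M : ℝ) (hM : 0 < M), ∃ ε > (0 : ℝ), ∃ C : ℝ, ∀ a : ℝ, |a| ≤ a₁ * M → ∀ (D : Literature.Geometry.Lorentzian.InitialDataSet 𝓘(ℝ, Literature.Geometry.Lorentzian.E3) (Literature.Geometry.Lorentzian.Kerr.slice a M)) [D.metric.HasLeviCivita], D.IsVacuumConstraintSolution → Literature.Geometry.Lorentzian.InitialDataSet.dataWeightedSobolevEDist s δ D (Literature.Geometry.Lorentzian.Kerr.data M a M hM.le) < ENNReal.ofReal ε → ∀ 𝒟 : Literature.Geometry.Lorentzian.VacuumCauchyDevelopment D, 𝒟.IsMaximal → ∃ (M' a' : ℝ) (𝒟oc : Set 𝒟.carrier), Literature.Geometry.Lorentzian.Kerr.IsSubextremal M' a' ∧ (∀ [𝒟.metric.HasLeviCivita], ∃ B₀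 : Set (Literature.Geometry.Lorentzian.Kerr.slice a M), IsCompact B₀ ∧ ∀ σ : ℝ, 0 < σ → ∃ B₁ : Set (Literature.Geometry.Lorentzian.Kerr.slice a M), IsCompact B₁ ∧ ∀ q ∈ {q : Literature.Geometry.Lorentzian.Kerr.slice a M | Literature.Geometry.Lorentzian.Kerr.afRadius a M + 1 ≤ ‖(q : Literature.Geometry.Lorentzian.E3)‖}, q ∉ B₁ → ∀ (ray : ℝ → 𝒟.carrier) (dom : Set ℝ), 𝒟.metric.IsNormalisedNullRayFrom 𝒟.timeOrientation 𝒟.embed 𝒟.normal q ray dom → ¬ BddAbove dom ∨ ENNReal.ofReal σ ≤ Literature.Geometry.Lorentzian.sojournTime ray dom (𝒟.metric.causalFuture 𝒟.timeOrientation (𝒟.embed '' B₀))) ∧ 𝒟.toSpacetime.ConvergesToKerr 𝒟oc M' a' k ∧ |M' - M| + |a' - a| ≤ C * √(Literature.Geometry.Lorentzian.InitialDataSet.dataWeightedSobolevEDist s δ D (Literature.Geometry.Lorentzian.Kerr.data M a M hM.le)).toReal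

/-- item stmt-FinalStateConjecture-9952 · support · rank 5 · open · by planner
why it might fail: = weak cosmic censorship (+MGHD existence, dischargeable from the vendored CBG fact) for one-ended AF vacuum data: open outside symmetry; vacuum naked singularities exist non-generically (RSR 2019); codim-1 curve-genericity may be the wrong exceptional-set notion near threshold laminations.
sources: Christodoulou1999, doi:10.2307/121023, arXiv:1912.08478, arXiv:0811.0354, arXiv:1710.01722, KehleUnger2025
[crux] (imported: the first conjunct-structure of the summit statement) for every connected
Hausdorff second-countable 3-manifold X, Christodoulou-generically in admissibleVacuumData X: a
maximal vacuum Cauchy development exists and every maximal vacuum Cauchy development has complete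
future null infinity (sojourn form, `Summit.FinalStateConjecture.HasCompleteNullInfinity`).
Necessary: the summit statement implies it by monotonicity of genericity (proved in Sketch.lean,
`wcc_of_statement`). Unlike `Literature.Geometry.Lorentzian.WeakCosmicCensorship` it is stated over
`VacuumCauchyDevelopment`, hence not vacuous. [difficulty: open-problem] -/
@[route_item "route-FinalStateConjecture-PhaseMixingCapture"]
def WeakCosmicCensorshipMGHD : Prop :=
  ∀ (X : Type) [TopologicalSpace X] [ChartedSpace Literature.Geometry.Lorentzian.E3 X] [IsManifold (𝓡 3) ((⊤ : ℕ∞) : WithTop ℕ∞) X] [T2Space X] [SecondCountableTopology X] [ConnectedSpace X], Literature.Geometry.Lorentzian.InitialDataSet.IsChristodoulouGeneric (Literature.Geometry.Lorentzian.admissibleVacuumData X) (fun D ↦ (∃ 𝒟 : Literature.Geometry.Lorentzian.VacuumCauchyDevelopment D, 𝒟.IsMaximal) ∧ ∀ 𝒟 : Literature.Geometry.Lorentzian.VacuumCauchyDevelopment D, 𝒟.IsMaximal → Summit.FinalStateConjecture.HasCompleteNullInfinity 𝒟.toCauchyDevelopment) 1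

/-- item stmt-FinalStateConjecture-14986 · support · rank 6 · open · by planner
why it might fail: Granted capture + censorship, generic exteriors may near the Kerr family without converging (no Liouville theorem for non-radiating exteriors beyond local rigidity), park at extremality generically, or recede as N ≥ 2 holes; the burial reading needs parametric gluing + hypersurface-MGHD realisation.
sources: arXiv:0904.0982, arXiv:1205.6112, arXiv:0902.1173, KehleUnger2025, AngelopoulosKehleUnger2026, Dafermos2025
[crux] (the large-data front end as ONE typed conditional; typing ruling 2026-08-16, successor of
CaptureSuffices as rank 6) NearExtremalKappaCapture → BulkKerrCaptureC2 → WeakCosmicCensorshipMGHD →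
FinalStateConjecture: granted κ-explicit near-extremal capture, C²-handing bulk capture and generic
completeness of 𝓘⁺, generic admissible data settle down exhaustively to finitely many sub-extremal
Kerr black holes plus radiation. Content: EITHER the dynamical front end (approach of generic
exteriors to the Kerr family along quiet windows, no parking at extremality — where the κ-power
basin makes polynomial closeness enough —, multi-hole bookkeeping, exhaustive charts; to be split
once ApproximateKerrConfiguration is defined) OR, for the summit as presently typed (topology-free
local curve-genericity), soft burial of the dilated datum in a slowly rotating Kerr exterior
consuming rank 4 once at |a| ≤ M/2. LINE EXISTS — no ideation needed:
Cruxes/CaptureSuffices/Lines/old_light_forces_soft_burial.lean (registered on the pre-ruling decl)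
ports verbatim with hypothesis BulkKerrCaptureC2 (its shields are b-conormal: compactly supported
smooth corrections of exact Kerr–Schild leaf data; qual -/
@[route_item "route-FinalStateConjecture-PhaseMixingCapture"]
def CaptureSufficesC2 : Prop :=
  NearExtremalKappaCapture → BulkKerrCaptureC2 → WeakCosmicCensorshipMGHD → FinalStateConjecture

/-- item stmt-FinalStateConjecture-9953 · support · rank 6 · open · by planner
why it might fail: Granted capture+censorship, generic large data may still settle to a smooth non-Kerr stationary vacuum hole (uniqueness needs analyticity or Kerr-closeness: AIK 0904.0982, CCH 1205.6112), near the Kerr family without converging, park at extremality, or keep N≥2 receding holes beyond finite-N capture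
sources: arXiv:0904.0982, arXiv:1205.6112, arXiv:0902.1173, KehleUnger2025, AngelopoulosKehleUnger2026, Dafermos2025
[crux] (the large-data front end as ONE typed conditional; ranked last only because it quantifies
over the decls above) NearExtremalKappaCapture → BulkKerrCapture → WeakCosmicCensorshipMGHD →
FinalStateConjecture: granted κ-explicit capture on the whole sub-extremal range and generic
completeness of 𝓘⁺, generic admissible data settle down exhaustively to finitely many sub-extremal
Kerr black holes plus radiation. Content: approach of the exterior to the Kerr family along quiet
windows, "no parking at extremality" for generic data (where the κ-power basin is what makes
polynomial closeness enough), multi-hole bookkeeping and the exhaustive charts; to be split in layer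
2 once `ApproximateKerrConfiguration` is defined. [deps: NearExtremalKappaCapture, BulkKerrCapture,
WeakCosmicCensorshipMGHD] [difficulty: open-problem] -/
@[route_item "route-FinalStateConjecture-PhaseMixingCapture"]
def CaptureSuffices : Prop :=
  NearExtremalKappaCapture → BulkKerrCapture → WeakCosmicCensorshipMGHD → FinalStateConjecture

-- earlier AxisymmetricKappaWaveDecay (stmt-FinalStateConjecture-9954, replaced 2026-08-15T16:23:04Z -> stmt-FinalStateConjecture-10751): retired by None — ∀ [Literature.Geometry.Lorentzian.Kerr.Facts] [Literature.Geometry.Lorentzian.Kerr.SliceFacts], ∀ M : ℝ, 0 < M → ∃ (p : ℝ) (j : ℕ), (∃ C : ENNReal, C < ⊤ ∧ ∀ a : ℝ, Literature.Geometry.Lorentzian.Kerr.IsSubextremal M a → ∀ ψ : Literature.Geometry.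
/-- item stmt-FinalStateConjecture-10751 · support · rank 9 · open · by planner
sources: Aretakis2012, arXiv:2212.13164, DafermosRodnianskiShlapentokhrothman2014, arXiv:gr-qc/0512119
[support] the axisymmetric (m = 0) case of KappaExplicitWaveDecay, with axisymmetry in Aretakis'
infinitesimal form Φψ = 0, typed ∀ x, mfderiv ψ x (Kerr.axialField a r₊ x) = 0 for the axial Killing
field Φ = ∂_φ* = x₁∂₂ − x₂∂₁ of KerrSchild.lean (cone repair of 2026-08-15: replaces
`Literature.Barriers.FinalStateConjecture.Kerr.IsAxisymmetric ψ`, rotation invariance — equivalent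
for smooth ψ — whose home module dragged the Aretakis barrier facts,
`extremalKerr_waveCauchyProblem` and the hyperboloidal-flux facts into the cone); the sector with no
superradiance and no azimuthal instability, where Aretakis 2012 / Giorgi–Wan physical-space
estimates at κ = 0 suggest small p; the first floor of the engine (implied by
KappaExplicitWaveDecay: `axisymmetric_of_general`, re-proved for the restated pair as
`axisym_of_kappa`). [difficulty: M] -/
@[route_item "route-FinalStateConjecture-PhaseMixingCapture"]
def AxisymmetricKappaWaveDecay : Prop :=
  ∀ [Literature.Geometry.Lorentzian.Kerr.Facts] [Literature.Geometry.Lorentzian.Kerr.SliceFacts], ∀ M : ℝ, 0 < M → ∃ (p : ℝ) (j : ℕ), (∃ C : ENNReal, C < ⊤ ∧ ∀ a : ℝ, Literature.Geometry.Lorentzian.Kerr.IsSubextremal M a → ∀ ψ : Literature.Geometry.Lorentzian.Kerr.exterior M a → ℝ, (ContMDiff 𝓘(ℝ, Literature.Geometry.Lorentzian.E4) 𝓘(ℝ, ℝ) ((⊤ : ℕ∞) : WithTop ℕ∞) ψ ∧ (∀ x, (Literature.Geometry.Lorentzian.Kerr.smoothMetric M a (Literature.Geometry.Lorentzian.Kerr.rPlus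 M a)).toPseudoRiemannianMetric.dalembertian ψ x = 0) ∧ ∃ K : Set (Literature.Geometry.Lorentzian.Kerr.exterior M a), IsCompact K ∧ ∀ x : Literature.Geometry.Lorentzian.Kerr.exterior M a, (x : Literature.Geometry.Lorentzian.E4) 0 = 0 → x ∉ K → ψ x = 0 ∧ mfderiv 𝓘(ℝ, Literature.Geometry.Lorentzian.E4) 𝓘(ℝ, ℝ) ψ x = 0) → (∀ x : Literature.Geometry.Lorentzian.Kerr.exterior M a, mfderiv 𝓘(ℝ, Literature.Geometry.Lorentzian.E4) 𝓘(ℝ, ℝ) ψ x (Literature.Geometry.Lorentzian.Kerr.axialField a (Literature.Geometry.Lorentzian.Kerr.rPlus M a) x) = 0) → ∀ τ : ℝ, 0 ≤ τ → Literature.Geometry.Lorentzian.sliceEnergy (Literature.Geometry.Lorentzian.Kerr.exterior M a) ψ τ ≤ C * ENNReal.ofReal ((1 - (a / M) ^ 2) ^ (-p)) * ∫⁻ y : Literature.Geometry.Lorentzian.E3, {y | Literature.Geometry.Lorentzian.E4.ofTimeSpace 0 y ∈ Literature.Geometry.Lorentzian.Kerr.exterior M a}.indicator (fun y ↦ ENNReal.ofReal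 (∑ m ∈ Finset.range (j + 1), ‖iteratedFDeriv ℝ m (Function.extend Subtype.val ψ (0 : Literature.Geometry.Lorentzian.E4 → ℝ)) (Literature.Geometry.Lorentzian.E4.ofTimeSpace 0 y)‖ ^ 2)) y) ∧ ∀ R : ℝ, ∃ C : ENNReal, C < ⊤ ∧ ∀ a : ℝ, Literature.Geometry.Lorentzian.Kerr.IsSubextremal M a → ∀ ψ : Literature.Geometry.Lorentzian.Kerr.exterior M a → ℝ, (ContMDiff 𝓘(ℝ, Literature.Geometry.Lorentzian.E4) 𝓘(ℝ, ℝ) ((⊤ : ℕ∞) : WithTop ℕ∞) ψ ∧ (∀ x, (Literature.Geometry.Lorentzian.Kerr.smoothMetric M a (Literature.Geometry.Lorentzian.Kerr.rPlus M a)).toPseudoRiemannianMetric.dalembertian ψ x = 0) ∧ ∃ K : Set (Literature.Geometry.Lorentzian.Kerr.exterior M a), IsCompact K ∧ ∀ x : Literature.Geometry.Lorentzian.Kerr.exterior M a, (x : Literature.Geometry.Lorentzian.E4) 0 = 0 → x ∉ K → ψ x = 0 ∧ mfderiv 𝓘(ℝ, Literature.Geometry.Lorentzian.E4) 𝓘(ℝ,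 ℝ) ψ x = 0) → (∀ x : Literature.Geometry.Lorentzian.Kerr.exterior M a, mfderiv 𝓘(ℝ, Literature.Geometry.Lorentzian.E4) 𝓘(ℝ, ℝ) ψ x (Literature.Geometry.Lorentzian.Kerr.axialField a (Literature.Geometry.Lorentzian.Kerr.rPlus M a) x) = 0) → ∫⁻ τ in Ioi (0 : ℝ), Literature.Geometry.Lorentzian.localSliceEnergy (Literature.Geometry.Lorentzian.Kerr.exterior M a) ψ τ R ≤ C * ENNReal.ofReal ((1 - (a / M) ^ 2) ^ (-p)) * ∫⁻ y : Literature.Geometry.Lorentzian.E3, {y | Literature.Geometry.Lorentzian.E4.ofTimeSpace 0 y ∈ Literature.Geometry.Lorentzian.Kerr.exterior M a}.indicator (fun y ↦ ENNReal.ofReal (∑ m ∈ Finset.range (j + 1), ‖iteratedFDeriv ℝ m (Function.extend Subtype.val ψ (0 : Literature.Geometry.Lorentzian.E4 → ℝ)) (Literature.Geometry.Lorentzian.E4.ofTimeSpace 0 y)‖ ^ 2)) y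

/-- item stmt-FinalStateConjecture-14714 · support · rank 9 · open · by planner
[support] glue (route-repair 2026-08-16, unused-crux): the NONLINEAR UPGRADE of the linear floor —
KappaExplicitWaveDecay → NearExtremalKappaCapture. Granted κ-explicit uniform boundedness +
integrated local energy decay for scalar waves on the whole sub-extremal Kerr range with constants
C(M)·(1 − a²/M²)^(−p) at finite regularity j (rank 3), the near-extremal nonlinear capture statement
with basin c(M)·(1 − a²/M²)^γ and modulus C(M)·(1 − a²/M²)^(−p)·√dist (rank 2, the first hypothesis
of `closes`) follows. Content = the route's engine above its floor: (i) the same κ-power law for the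
Teukolsky / generalised Regge–Wheeler system of linearised gravity (Chandrasekhar-type
transformation as in DHR / Shlapentokh-Rothman–Teixeira da Costa, with the κ-dependence tracked);
(ii) the Klainerman–Szeftel / GKS nonlinear scheme (GCM spheres, PT frames, r^p hierarchies) run
with bootstrap constants polynomial in κ⁻¹, the loss absorbed by the κ-power basin radius; (iii)
modulation of the final parameters (M′, a′) with the κ-power modulus, final hole sub-extremal. This
is exactly the edge whose failure the route's KILL CRITERIA call "the obstruction is nonlinear
(echo/feedback)": ¬NonlinearKappaU -/
@[route_item "route-FinalStateConjecture-PhaseMixingCapture"]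
def NonlinearKappaUpgrade : Prop :=
  KappaExplicitWaveDecay → NearExtremalKappaCapture

-- earlier Assembly (stmt-FinalStateConjecture-14875, replaced 2026-08-16T07:06:51Z -> stmt-FinalStateConjecture-14987): retired by None — NearExtremalKappaCapture ∧ BulkKerrCapture ∧ WeakCosmicCensorshipMGHD → FinalStateConjecture
-- earlier Assembly (stmt-FinalStateConjecture-14987, replaced 2026-08-16T23:16:41Z -> stmt-FinalStateConjecture-17346): retired by None — NearExtremalKappaCapture ∧ BulkKerrCaptureC2 ∧ WeakCosmicCensorshipMGHD → FinalStateConjecture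
-- earlier Assembly (stmt-FinalStateConjecture-9955, replaced 2026-08-16T06:39:16Z -> stmt-FinalStateConjecture-14875): proved by Summit.FinalStateConjecture.FinalStateConjecture.Theorems.PhaseMixingCapture.assembly_frame_proof — NearExtremalKappaCapture → BulkKerrCapture → WeakCosmicCensorshipMGHD → CaptureSuffices → FinalStateConjecture
/-- item stmt-FinalStateConjecture-17346 · assembly · rank 1 · open · by planner
sources: arXiv:1710.01722, arXiv:2603.10378
[assembly] the route assembly claim in conjunctive form after the statement revision p126844
(re-type T2, 2026-08-16): κ-explicit near-extremal capture (NearExtremalKappaCapture) ∧ C²-handing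
bulk sub-extremal capture (BulkKerrCaptureC2) ∧ TAME weak cosmic censorship with MGHD existence
(WeakCosmicCensorshipTame, the summit own genericity notion) ⟹ the re-typed summit statement.
Content = the conditional crux CaptureSufficesTame (rank 6) uncurried: whoever proves
CaptureSufficesTame closes this item by `fun ⟨h₁, h₂, h₃⟩ ↦ hS h₁ h₂ h₃`; the linear floor enters
through the support NonlinearKappaUpgrade (KappaExplicitWaveDecay → NearExtremalKappaCapture). The
deciding theorem `closes : NearExtremalKappaCapture → BulkKerrCaptureC2 → WeakCosmicCensorshipTame →
CaptureSufficesTame → FinalStateConjecture` (modus ponens, crux-only, rev 18) is what decides the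
route. Replaces the rev-16 form over the pre-revision WeakCosmicCensorshipMGHD (plain genericity,
now a support). sources: arXiv:1710.01722, arXiv:2603.10378 -/
@[route_item "route-FinalStateConjecture-PhaseMixingCapture"]
def Assembly : Prop :=
  NearExtremalKappaCapture ∧ BulkKerrCaptureC2 ∧ WeakCosmicCensorshipTame → FinalStateConjecture

-- records of items no longer active in this route (dropped / restated):
-- earlier KappaCaptureThesis (stmt-FinalStateConjecture-14862, replaced 2026-08-16T06:41:22Z -> stmt-FinalStateConjecture-14882): retired by None — NearExtremalKappaCapture ∧ BulkKerrCapture ∧ WeakCosmicCensorshipMGHD ∧ CaptureSuffices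

/-! D-0027 §2.1 — DECIDING THEOREM (planner-authored via `route open/edit --closes-file`; by planner-rrepair-FinalStateConjecture-PhaseMixi-0a0fc589-0 2026-08-16T23:16:00Z):
its hypotheses are this route's items and its conclusion the sub-problem Statement (glue_lint), and it elaborates with this file. -/

/-- DECIDING THEOREM (D-0027 §2.1; statement revision p126844, re-type T2, 2026-08-16). The route's
assembly is pure logic: the front end is the typed conditional crux `CaptureSufficesTame`
(κ-explicit near-extremal capture → C²-handing bulk capture → TAME weak cosmic censorship with MGHD
existence → the summit statement BY NAME), so the re-typed summit — tame genericity on one fixed end,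
honest near-zone radii, future-oriented charts, rays stay in the closure of the settled region — follows
from the four crux items by modus ponens (crux-only deciding theorem); the new conjuncts are obligations
of the front end, where the decomposition witness is built, and the genericity notion of the censorship
hypothesis now MATCHES the summit's (`WeakCosmicCensorshipTame`, rank 5). The linear floor
`KappaExplicitWaveDecay` (rank 3, deciding crux) feeds the first hypothesis through the support
`NonlinearKappaUpgrade`; the pre-revision `WeakCosmicCensorshipMGHD` (implied by rank 5: tame ⇒ plain
genericity) and `CaptureSufficesC2` (implies rank 6) stay in the file as supports / implication records,
as do the pre-ruling `BulkKerrCapture` / `CaptureSuffices`. -/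
@[closes "route-FinalStateConjecture-PhaseMixingCapture"] theorem closes (h₁ : NearExtremalKappaCapture) (h₂ : BulkKerrCaptureC2) (h₃ : WeakCosmicCensorshipTame)
    (h₄ : CaptureSufficesTame) : FinalStateConjecture :=
  h₄ h₁ h₂ h₃

end Summit.FinalStateConjecture.FinalStateConjecture.Theses.PhaseMixingCapture
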